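import Literature.Geometry.Lorentzian.HawkingCrushBoundFirstVariation
import Literature.Geometry.Lorentzian.HawkingCrushBoundSecondVariation
import Literature.Geometry.Lorentzian.HawkingCrushBoundProofs
import Literature.Geometry.Lorentzian.MaximalCausalGeodesicCompact
import Literature.Geometry.Lorentzian.CauchyHypersurfaceGlobalHyperbolicity
import Literature.Geometry.Lorentzian.CausalityClosedProofs
import Literature.Geometry.Lorentzian.GeodesicSpeed
import Literature.Geometry.Riemannian.EndmanifoldVariation
import HarnessLib

/-!
# Hawking's crush bound: `HawkingCrushBound_holds` (Wald 1984, Thm. 9.5.1; O'Neill 1983, Thm. 14.55A)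

This file completes the proof of `HawkingCrushBound`
(`Literature.Geometry.Lorentzian.HawkingCrushBound`): in a globally hyperbolic four-dimensional
spacetime satisfying the timelike convergence condition, if a smooth spacelike Cauchy hypersurface
`f : N → M` has mean curvature `H ≤ -C < 0` with respect to its future unit normal `ν`, then
`τ(f y, q) ≤ 3/C` for all `y`, `q` (Wald 1984, Thm. 9.5.1, p. 237; O'Neill 1983, Ch. 14,
Thm. 14.55A, pp. 431–432; Hawking 1967).

The two halves of O'Neill's proof were proved in sibling files: the second-variation half
`length_le_of_maximal_normalGeodesic` (`HawkingCrushBoundSecondVariation`, O'Neill's Prop. 10.37)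
and the assembly `HawkingCrushBound_of_maximiser_of_secondVariation` (`HawkingCrushBoundProofs`).
Here we prove the **maximiser half** `exists_maximal_normalGeodesic_of_isCauchyHypersurface`
(O'Neill 1983, Ch. 14, Thm. 14.44, first half): to every `q` with `τ(f y, q) > 0` there is a
NORMAL geodesic `t ↦ exp_{f y₀}(t ν(y₀))`, `t ∈ [0, L₀]`, ending at `q`, which is length-maximising
among all future causal curves from `f(N)` to `q`. The maximal geodesic from the compact set
`f(N) ∩ J⁻(q)` to `q` is `exists_maximal_geodesic_of_isCompact` (`MaximalCausalGeodesicCompact`: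
limit curves, Lemma 14.14; reverse triangle inequality; corner cutting, Prop. 10.46; all inside
the compact set `J⁺(f(N)) ∩ J⁻(q)` of Lemma 14.40); it is timelike, and it is normal to `f` by
the first variation of arc length (`firstVariation_of_maximal`, O'Neill's Cor. 10.26) and the
characterisation of the normal line of a spacelike hypersurface
(`eq_smul_normal_of_forall_val_mfderiv_eq_zero`). Then `HawkingCrushBound_holds` follows.

Everything is proved; no definitions and no named facts are introduced (D-0026).

## References

* R. M. Wald, *General Relativity*, Chicago 1984, Thm. 9.4.5, Thm. 9.5.1 (pp. 237–238).
  [Wald1984GR]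
* B. O'Neill, *Semi-Riemannian geometry with applications to relativity*, Academic Press 1983,
  Ch. 10, Cor. 10.26, Prop. 10.37, Prop. 10.46; Ch. 14, Lemma 14.14, Prop. 14.19, Lemma 14.40,
  Thm. 14.44, Thm. 14.55A (pp. 408–432). [ONeillSemiRiemannian1983]
* S. W. Hawking, Proc. R. Soc. Lond. A 300 (1967) 187–201. [Hawking1967]
-/

noncomputable section

open Bundle Set Function Filter
open scoped Manifold ContDiff Topology ENNReal

universe u

namespace Literature.Geometry.Lorentzian

open Literature.Geometry.Riemannian PseudoRiemannianMetric LorentzianMetric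

set_option maxHeartbeats 1600000 in
/-- **The maximising normal geodesic from a Cauchy hypersurface** (O'Neill 1983, Ch. 14,
Thm. 14.44, first half; Wald 1984, Thm. 9.4.5). Let `(M, g)` be a four-dimensional spacetime,
`f : N → M` a smooth spacelike immersion of a `3`-manifold with future unit normal field `ν` whose
range is a Cauchy hypersurface, and `τ(f y, q) > 0`. Then there are `y₀` and `L₀ > 0` such that the
normal geodesic `t ↦ exp_{f y₀}(t ν(y₀))` is defined on `[0, L₀]`, ends at `q`, and every future
causal curve from a point of `f(N)` to `q` has length `≤ L₀`.
[cite: ONeillSemiRiemannian1983, Ch. 14, Thm. 14.44 (p. 427)] [cite: Wald1984GR, Thm. 9.4.5] -/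
theorem exists_maximal_normalGeodesic_of_isCauchyHypersurface (𝓢 : Spacetime.{u} 4)
    [𝓢.metric.HasLeviCivita]
    {N : Type u} [TopologicalSpace N] [ChartedSpace E3 N] [IsManifold (𝓡 3) ∞ N]
    {f : N → 𝓢.carrier} (hf : 𝓢.metric.IsSpacelikeImmersion (𝓡 3) f) {ν : NormalField (𝓡 4) f}
    (hfun : 𝓢.metric.IsFutureUnitNormal (𝓡 3) 𝓢.timeOrientation f ν)
    (hS : 𝓢.metric.IsCauchyHypersurface 𝓢.timeOrientation (range f))
    {y : N} {q : 𝓢.carrier} (hpos : 0 < 𝓢.lorentzDist (f y) q) :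
    ∃ (y₀ : N) (L₀ : ℝ), 0 < L₀ ∧
      Icc 0 L₀ ⊆ maximalGeodesicDomain 𝓢.metric.leviCivita (f y₀) (ν y₀) ∧
      expMap 𝓢.metric.leviCivita (f y₀) (L₀ • ν y₀) = q ∧
      ∀ (y' : N) (γ : ℝ → 𝓢.carrier) (a b : ℝ), a < b →
        𝓢.metric.IsFutureCausalCurveOn 𝓢.timeOrientation γ (Icc a b) → γ a = f y' → γ b = q →
        𝓢.metric.arcLength γ a b ≤ ENNReal.ofReal L₀ := by
  classical
  /- 0. Notation and regularity. -/
  let M := 𝓢.carrier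
  let g := 𝓢.metric
  let τ := 𝓢.timeOrientation
  let cov := 𝓢.metric.leviCivita
  have hk1 : (((1 : ℕ∞) : ℕ∞ω)) + 1 ≤ ((⊤ : ℕ∞) : ℕ∞ω) := by exact_mod_cast le_top
  have hkT : (((⊤ : ℕ∞) : ℕ∞ω)) + 1 ≤ ((⊤ : ℕ∞) : ℕ∞ω) := by exact_mod_cast le_top
  have hreg₁ : cov.IsLocallyContMDiff 1 := 𝓢.metric.isLocallyContMDiff_leviCivita_holds 1 hk1
  have hreg : cov.IsLocallyContMDiff ∞ := 𝓢.metric.isLocallyContMDiff_leviCivita_holds ⊤ hkT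
  haveI : CovariantDerivative.ContMDiffCovariantDerivative cov 1 := ⟨hreg₁ univ isOpen_univ⟩
  haveI : CovariantDerivative.ContMDiffCovariantDerivative cov (⊤ : ℕ∞) :=
    ⟨hreg univ isOpen_univ⟩
  have hn : ((⊤ : ℕ∞) : ℕ∞ω) ≤ ((⊤ : ℕ∞) : ℕ∞ω) := le_rfl
  have hn2 : (2 : ℕ∞ω) ≤ ((⊤ : ℕ∞) : ℕ∞ω) := WithTop.coe_le_coe.mpr le_top
  have hsc : g.IsStronglyCausal τ := hS.isStronglyCausal hn
  /- 1. The compact sets `K = f(N) ∩ J⁻(q)` and `K' = J⁻(q) ∩ J⁺(f(N))`. -/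
  have hK'c : IsCompact (g.causalPast τ {q} ∩ g.causalFuture τ (range f)) :=
    hS.isCompact_causalPast_inter_causalFuture hn q
  let K : Set M := range f ∩ g.causalPast τ {q}
  have hKcpt : IsCompact K := by
    have hcl : IsClosed (range f) := IsCauchyHypersurface.isClosed_holds (g := g) (τ := τ) hn2 hS
    refine hK'c.of_isClosed_subset (hcl.inter (hS.isClosed_causalPast_singleton hn q)) ?_
    exact fun p hp ↦ ⟨hp.2, subset_causalFuture g τ _ hp.1⟩
  have hpos' : 0 < g.lorentzDist τ (f y) q := hpos
  have hyq : q ∈ g.causalFuture τ {f y} := mem_causalFuture_of_lorentzDist_ne_zero hpos'.ne'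
  have hyK : f y ∈ K := ⟨mem_range_self y, mem_causalPast_singleton_iff.2 hyq⟩
  -- causal curves from `K` to `q` stay in `K'`
  have hAK : ∀ (γ : ℝ → M) (a b : ℝ), a ≤ b → g.IsFutureCausalCurveOn τ γ (Icc a b) → γ a ∈ K →
      γ b = q → MapsTo γ (Icc a b) (g.causalPast τ {q} ∩ g.causalFuture τ (range f)) := by
    intro γ a b hab hγ ha hb t ht
    constructor
    · rw [mem_causalPast_singleton_iff, ← hb]
      exact Literature.Geometry.Lorentzian.IsFutureCausalCurveOn.apply_mem_causalFuture τ ht.2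
        (hγ.mono (Icc_subset_Icc ht.1 le_rfl))
    · rcases ht.1.eq_or_lt with h | h
      · rw [← h]; exact subset_causalFuture g τ _ ha.1
      · exact Or.inr ⟨γ a, ha.1, γ, a, t, h, hγ.mono (Icc_subset_Icc le_rfl ht.2), rfl, rfl⟩
  /- 2. The maximal timelike geodesic from `K` to `q`. -/
  obtain ⟨p₀, hp₀K, u, T, hT, hDom, huu, hufut, hend, hdle⟩ :=
    exists_maximal_geodesic_of_isCompact τ hn hsc hKcpt hK'c hAK ⟨f y, hyK, hpos'⟩
  obtain ⟨y₀, hy₀⟩ := hp₀K.1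
  -- transport the data to the base point `f y₀`
  subst hy₀
  obtain ⟨hMu, h0u, hγ0, hγv⟩ := maximalGeodesic_spec' (cov := cov) (f y₀) u
  obtain ⟨ε, hε, hIoo⟩ := exists_Ioo_subset_of_Icc_subset hT.le hMu.isOpen hDom
  let a' : ℝ := 0 - ε
  let b' : ℝ := T + ε
  have ha' : a' < 0 := by simp only [a']; linarith
  have hb' : T < b' := by simp only [b']; linarith
  have hdomv : Ioo a' b' ⊆ maximalGeodesicDomain cov (f y₀) u := hIoo
  have hbI : T ∈ Ioo a' b' := ⟨ha'.trans hT, hb'⟩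
  let v₀ : TangentSpace (𝓡 4) (f y₀) := u
  have hv₀ : v₀ = u := rfl
  let c₀ : ℝ := 1
  have hc₀ : (0 : ℝ) < c₀ := one_pos
  have hγexp : ∀ t ∈ Ioo a' b', maximalGeodesic cov (f y₀) u t = expMap cov (f y₀) (t • v₀) :=
    fun t ht ↦ ((expMap_smul_of_mem (cov := cov) (f y₀) u (hdomv ht)).2).symm
  have hfut : τ.IsFutureDirected v₀ := hufut
  -- maximality among curves from `f(N)` to `q`
  have hmaxK : ∀ (y' : N) (γ' : ℝ → M) (a₁ b₁ : ℝ), a₁ < b₁ →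
      g.IsFutureCausalCurveOn τ γ' (Icc a₁ b₁) → γ' a₁ = f y' → γ' b₁ = q →
      g.arcLength γ' a₁ b₁ ≤ ENNReal.ofReal T := by
    intro y' γ' a₁ b₁ hab hγ' h1 h2
    have hy'K : f y' ∈ K := ⟨mem_range_self y',
      mem_causalPast_singleton_iff.2 (Or.inr ⟨f y', rfl, γ', a₁, b₁, hab, hγ', h1, h2⟩)⟩
    calc g.arcLength γ' a₁ b₁ ≤ g.lorentzDist τ (f y') q := arcLength_le_lorentzDist hab hγ' h1 h2
      _ ≤ ENNReal.ofReal T := hdle _ hy'K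
  /- 5. Normality: `g(df w, v₀) ≤ 0` for all `w` (first variation), hence `= 0`. -/
  obtain ⟨Z, hZs, hZ0⟩ := exists_contMDiff_tangentSection_eq (I := 𝓡 4) (f y₀) v₀
  let νt : NormalField (𝓡 4) f := fun y' ↦ Z (f y')
  have hνts : ContMDiff (𝓡 3) (𝓡 4).tangent ∞
      (fun y' ↦ (TotalSpace.mk' E4 (f y') (νt y') : TangentBundle (𝓡 4) M)) :=
    hZs.comp hf.contMDiff_self
  have hνt0 : νt y₀ = v₀ := hZ0
  have hvv : g.val (f y₀) (νt y₀) (νt y₀) = -c₀ ^ 2 := by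
    rw [hνt0, hv₀, huu]; simp only [c₀]; norm_num
  have hfut' : τ.IsFutureDirected (νt y₀) := by
    rw [hνt0]
    exact hfut
  have hdom' : Ioo a' b' ⊆ maximalGeodesicDomain cov (f y₀) (νt y₀) := by
    rw [hνt0]
    exact hdomv
  have hγb' : expMap cov (f y₀) (T • νt y₀) = q := by
    rw [hνt0, ← hγexp T hbI]; exact hend
  have hmax' : ∀ (y' : N) (γ' : ℝ → M) (a₁ b₁ : ℝ), a₁ < b₁ →
      g.IsFutureCausalCurveOn τ γ' (Icc a₁ b₁) → γ' a₁ = f y' →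
      γ' b₁ = expMap cov (f y₀) (T • νt y₀) → g.arcLength γ' a₁ b₁ ≤ ENNReal.ofReal (c₀ * T) := by
    intro y' γ' a₁ b₁ hab hγ' h1 h2
    rw [hγb'] at h2
    simp only [c₀, one_mul]
    exact hmaxK y' γ' a₁ b₁ hab hγ' h1 h2
  have hγesm : ∀ t ∈ maximalGeodesicDomain cov (f y₀) (νt y₀), ContMDiffAt 𝓘(ℝ, ℝ) (𝓡 4) ∞
      (fun t ↦ expMap cov (f y₀) (t • νt y₀)) t := fun t ht ↦
    (contMDiffAt_normalExp (cov := cov) (k := (⊤ : ℕ∞)) (ι := f) (ν := νt) le_top hνts ht).comp t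
      (contMDiffAt_const.prodMk contMDiffAt_id)
  have hγe0 : expMap cov (f y₀) ((0 : ℝ) • νt y₀) = f y₀ := by
    rw [zero_smul]
    exact expMap_zero (cov := cov) (f y₀)
  let φ : ℝ → ℝ := fun t ↦ 1 - t / T
  have hφdef : φ = fun t ↦ 1 - t / T := rfl
  have hφs : ContDiff ℝ ∞ φ := contDiff_const.sub (contDiff_id.div_const _)
  have hperp : ∀ w : TangentSpace (𝓡 3) y₀, g.val (f y₀) (mfderiv (𝓡 3) (𝓡 4) f y₀ w) v₀ ≤ 0 := by
    intro w
    obtain ⟨Zw, hZws, hZw0⟩ :=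
      exists_contMDiff_tangentSection_eq (I := 𝓡 4) (f y₀) (mfderiv (𝓡 3) (𝓡 4) f y₀ w)
    let V : Π t : ℝ, TangentSpace (𝓡 4) (expMap cov (f y₀) (t • νt y₀)) :=
      fun t ↦ φ t • (Zw (expMap cov (f y₀) (t • νt y₀)) :
        TangentSpace (𝓡 4) (expMap cov (f y₀) (t • νt y₀)))
    have hVdef : V = fun t ↦ φ t • (Zw (expMap cov (f y₀) (t • νt y₀)) :
        TangentSpace (𝓡 4) (expMap cov (f y₀) (t • νt y₀))) := rfl
    have hVsm : ∀ t ∈ Ioo a' b', ContMDiffAt 𝓘(ℝ, ℝ) (𝓡 4).tangent ∞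
        (fun t' ↦ (TotalSpace.mk' E4 (expMap cov (f y₀) (t' • νt y₀)) (V t') :
          TangentBundle (𝓡 4) M)) t := by
      intro t ht
      have hJ : ContMDiffAt 𝓘(ℝ, ℝ) (𝓡 4).tangent ∞
          (fun t' ↦ (TotalSpace.mk' E4 (expMap cov (f y₀) (t' • νt y₀))
            (Zw (expMap cov (f y₀) (t' • νt y₀))) : TangentBundle (𝓡 4) M)) t :=
        (hZws _).comp t (hγesm t (hdom' ht))
      have h1 := contMDiffAt_totalSpaceMk_smul (I := 𝓡 4)
        (c := fun t' ↦ expMap cov (f y₀) (t' • νt y₀))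
        (V := fun t' ↦ Zw (expMap cov (f y₀) (t' • νt y₀))) hJ (φ t)
      have h2 : ContMDiffAt 𝓘(ℝ, ℝ) (𝓘(ℝ, ℝ).prod 𝓘(ℝ, ℝ)) ∞
          (fun t' : ℝ ↦ ((φ t', t') : ℝ × ℝ)) t := (hφs.contMDiff t).prodMk contMDiffAt_id
      have h3 : ContMDiffAt 𝓘(ℝ, ℝ) (𝓡 4).tangent ∞
          (fun t' ↦ (TotalSpace.mk' E4 (expMap cov (f y₀) (t' • νt y₀))
            (φ t' • Zw (expMap cov (f y₀) (t' • νt y₀))) : TangentBundle (𝓡 4) M)) t :=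
        h1.comp_of_eq h2 rfl
      exact h3
    have hVb : V T = 0 := by
      simp only [hVdef, hφdef, div_self hT.ne', sub_self, zero_smul]
    have hV0 : V 0 = mfderiv (𝓡 3) (𝓡 4) f y₀ w := by
      have hφ0 : φ 0 = 1 := by simp [hφdef]
      simp only [hVdef, hφ0, one_smul]
      rw [hγe0]
      exact hZw0
    have h := firstVariation_of_maximal 𝓢 hf hνts hc₀ hvv hfut' ha' hT hb' hdom' hmax' hVsm hVb
      hV0
    rw [hνt0] at h
    exact h
  have hperp0 : ∀ w : TangentSpace (𝓡 3) y₀,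
      g.val (f y₀) v₀ (mfderiv (𝓡 3) (𝓡 4) f y₀ w) = 0 := by
    intro w
    have h1 := hperp w
    have h2 := hperp (-w)
    rw [map_neg, map_neg, neg_apply] at h2
    rw [g.symm]
    linarith
  have hdim : Module.finrank ℝ E3 + 1 = Module.finrank ℝ E4 := by simp
  have hv₀eq := g.toPseudoRiemannianMetric.eq_smul_normal_of_forall_val_mfderiv_eq_zero
    (I' := 𝓡 3) hf hfun.1 hdim hperp0
  let α : ℝ := -(g.val (f y₀) v₀ (ν y₀))
  have hνν : g.val (f y₀) (ν y₀) (ν y₀) = -1 := hfun.1.2 y₀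
  have hα2 : α ^ 2 = c₀ ^ 2 := by
    have h1 : g.val (f y₀) v₀ v₀ = α ^ 2 * g.val (f y₀) (ν y₀) (ν y₀) := by
      rw [hv₀eq, map_smul, map_smul, smul_apply, smul_eq_mul, smul_eq_mul]
      ring
    rw [hνν, hv₀, huu] at h1
    simp only [c₀]
    linarith
  have hαpos : 0 < α := by
    have h1 : g.val (f y₀) (τ.vectorField (f y₀)) v₀ < 0 := hfut.2
    have h2 : g.val (f y₀) (τ.vectorField (f y₀)) (ν y₀) < 0 := (hfun.2 y₀).2
    rw [hv₀eq, map_smul, smul_eq_mul] at h1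
    by_contra hαle
    rw [not_lt] at hαle
    nlinarith [mul_nonneg_of_nonpos_of_nonpos hαle h2.le]
  have hαc : α = c₀ := by
    rw [← Real.sqrt_sq hαpos.le, hα2, Real.sqrt_sq hc₀.le]
  have hv₀ν : v₀ = c₀ • ν y₀ := by rw [← hαc]; exact hv₀eq
  /- 6. Conclusion with `L₀ = T`. -/
  have huν : u = ν y₀ := by
    have h := hv₀ν
    rw [hv₀, ← hαc] at h
    rw [h, hαc]
    simp only [c₀, one_smul]
  refine ⟨y₀, T, hT, ?_, ?_, hmaxK⟩
  · rw [← huν]; exact hDom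
  · rw [← huν, ← hγexp T hbI]; exact hend

/-- **Hawking's crush bound** (Wald 1984, Thm. 9.5.1, p. 237; O'Neill 1983, Ch. 14, Thm. 14.55A;
Hawking 1967): `HawkingCrushBound` holds — in a globally hyperbolic four-dimensional spacetime
satisfying the timelike convergence condition, if a smooth spacelike Cauchy hypersurface has mean
curvature `H ≤ -C < 0` with respect to its future unit normal, then every event lies within time
separation `3/C` of it. Proof: O'Neill's Thm. 14.55A — the maximising normal geodesic
(`exists_maximal_normalGeodesic_of_isCauchyHypersurface`, Thm. 14.44) has length `≤ 3/C` by the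
second variation (`length_le_of_maximal_normalGeodesic`, Prop. 10.37), assembled by
`HawkingCrushBound_of_maximiser_of_secondVariation`.
[cite: Wald1984GR, Theorem 9.5.1 (pp. 237–238)]
[cite: ONeillSemiRiemannian1983, Ch. 14, Thm. 14.55A (pp. 431–432)] -/
theorem HawkingCrushBound_holds : HawkingCrushBound.{u} :=
  HawkingCrushBound_of_maximiser_of_secondVariation
    (fun 𝓢 _ _ _ _ _ _ _ hf _ _ hfun hS _ _ hpos ↦
      exists_maximal_normalGeodesic_of_isCauchyHypersurface 𝓢 hf hfun hS hpos)
    (fun 𝓢 _ htc N _ _ _ f hpb hf ν hν hfun y₀ L₀ hL₀ hdom hmax C hC hH ↦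
      length_le_of_maximal_normalGeodesic 𝓢 htc N f hpb hf ν hν hfun y₀ L₀ hL₀ hdom hmax C hC hH)

end Literature.Geometry.Lorentzian

end
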